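import Summits.BirchSwinnertonDyer.BirchSwinnertonDyer.Theorems.SylvesterTwoHeegnerIndexCMFlipLevelPrime
import Summits.BirchSwinnertonDyer.BirchSwinnertonDyer.Theorems.SylvesterTwoHeegnerIndexCMFlipBottomKummer
import Summits.BirchSwinnertonDyer.BirchSwinnertonDyer.Theorems.SylvesterTwoHeegnerIndexCMFlipCoherentFrame
import Summits.BirchSwinnertonDyer.BirchSwinnertonDyer.Theorems.SylvesterTwoHeegnerIndexCMDataCoupledFrame
import Summits.BirchSwinnertonDyer.BirchSwinnertonDyer.Theorems.SylvesterTwoHeegnerIndexUpperOffV0KolyvaginPrimesSupersingularTwo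
import Summits.BirchSwinnertonDyer.Rank1Residual.X11b.KolyvaginTowerLiftConcrete
import Literature.NumberTheory.EllipticCurves.CMPointsCongruenceRelation
import Literature.NumberTheory.EllipticCurves.HuShuYin2019.SylvesterPairAdditivePlaces
import Literature.NumberTheory.EllipticCurves.JZeroKolyvaginPrimes
import HarnessLib

/-!
# (H-b) of leaf (L1), crux `UpperOffV0HSYPlus` (stmt-BirchSwinnertonDyer-19804): BLOCK 1 OF (L1) AT ONE KOLYVAGIN
# PRIME from the coherent data — #F1's FLIP with (ES2) discharged by the named fact and the bottom class
# identified with `δ Y₁`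

Skeleton of record VARIANT M (`Cruxes/UpperOffV0HSYPlus/Lines/coupled_variantM.lean` 406ca288e244d392);
card v28; planner D472/D475.  ONE main theorem `block1_of_level`: for the global data of the rows' assembly
(#H-a: coherent `emb₀ ⊂ emb`, pinned `κ`, bottom transversal `t`; #R-g: the coupled frame; #19's transport
equation for `Y₁`) and ONE prime `ℓ` satisfying `stub_layerL1Four`'s Kolyvagin clause, with a generator `σ_ℓ`
and the CM point `y_ℓ`: the class term `c_A(ℓ) = c(ψ_A(Σᵢ ρ²_{tᵢ}(tᵢ • κ⁻¹ι_e(D_ℓ y_ℓ))))` is well-formed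
(`hA₁`, `hQN`, `hP₁` — #R-g `coupledFrame_levelPackage`, #R-c) and
**`c_A(ℓ)` Selmer at `λ ∋ ℓ` ↔ `kummerClassOfPoint Y₁ ∈ T_B(λ)`** (#F1 `flip_levelPrime`; `hES` from #20
`geomReduction_sylvester_prime_eq_frob_smul` GRANTED `Nekovar2007.cmPoint_frobeniusCongruence`; bottom class = `δ Y₁`
by #G).  Also `mod_three_eq_two_of_clause`: the clause forces `ℓ ≡ 2 (3)`, `ℓ ∤ p`.

Theorems only; no `def`, no `sorry`, no new `Prop`; `set_option maxHeartbeats 1600000 in` scoped to the one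
theorem (its statement alone carries #F1's ~45 binders).  Honest label: (F)+(G)+(H) close `stub_layerL1Four`
only MODULO {`hD` #19, `Dt`/`hdeg`, (ES2) = `Nekovar2007.cmPoint_frobeniusCongruence`}; BSD is not proved by any
of this.
-/

set_option linter.dupNamespace false
set_option autoImplicit false

noncomputable section

open scoped Classical Pointwise

namespace Summit.BirchSwinnertonDyer.BirchSwinnertonDyer.Theorems.SylvesterTwoCMFlip

open WeierstrassCurve Field NumberField IsDedekindDomain Finset
open Literature.NumberTheory.EllipticCurves Literature.NumberTheory.GaloisRepresentations
  Literature.NumberTheory.EllipticCurves.ModularForms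
  Literature.NumberTheory.EllipticCurves.HuShuYin2019
  Literature.NumberTheory.EllipticCurves.KolyvaginCocycle
  Literature.NumberTheory.EllipticCurves.RingClassField
  Summit.BirchSwinnertonDyer.BirchSwinnertonDyer.Theorems.SylvesterTwoCMData
  Summit.BirchSwinnertonDyer.Rank1Residual.X11b

variable {K : Type} [Field K] [NumberField K]

/-- The Kolyvagin clause of `stub_layerL1Four` at `ℓ` forces `ℓ ≡ 2 (mod 3)` and `ℓ ∤ p` (`p ≡ 1 (mod 3)`):
`ℓ ∤ d_K = −3` gives `ℓ ≠ 3`, and `Frob_ℓ = Frob_∞` on `E_p[2]` gives `ℓ` inert in `ℚ(ω)`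
(`mod_three_eq_two_of_frobEqFrobInfty_two`). [cite: GrossLMS1991, §3 (3.2)] -/
theorem mod_three_eq_two_of_clause {ω : K} (hω : ω ^ 2 + ω + 1 = 0) (h2 : Module.finrank ℚ K = 2)
    {p ℓ : ℕ} (hp : p.Prime) (hp3 : p % 3 = 1) (hℓ : ℓ.Prime) (hℓdK : ¬ ((ℓ : ℤ) ∣ NumberField.discr K))
    (hFrobB : FrobEqFrobInfty (cubeSumCurve (p : ℚ)) K 2 ℓ) : ℓ % 3 = 2 ∧ ¬ ℓ ∣ p := by
  have hdK := JZero.discr_eq_neg_three_of_sq_add_self_add_one hω h2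
  have hℓ3 : ℓ ≠ 3 := by
    rintro rfl; rw [hdK] at hℓdK; exact hℓdK ⟨-1, by norm_num⟩
  have hp0' : (p : ℚ) ≠ 0 := by exact_mod_cast hp.ne_zero
  haveI : (cubeSumCurve (p : ℚ)).IsElliptic := by
    have h := isElliptic_cubeSumCurve_baseChange ℚ hp0'
    rwa [WeierstrassCurve.baseChange, Algebra.algebraMap_self, WeierstrassCurve.map_id] at h
  have hCW : (1 : VariableChange ℚ) • cubeSumCurve (p : ℚ) = ⟨0, 0, 0, 0, -(432 * (p : ℚ) ^ 2)⟩ := by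
    rw [one_smul, cubeSumCurve, neg_mul]
  have h3 := SylvesterTwoUpper.mod_three_eq_two_of_frobEqFrobInfty_two (cubeSumCurve (p : ℚ)) hCW hℓ hℓ3 hFrobB
  refine ⟨h3, fun h ↦ ?_⟩
  have := (Nat.prime_dvd_prime_iff_eq hℓ hp).mp h
  omega

set_option maxHeartbeats 1600000 in
/-- **(H-b) BLOCK 1 OF (L1) AT ONE KOLYVAGIN PRIME, from the coherent data.**  Given the global data of the rows'
assembly — the pinned equivariant `κ`, the coupled frame (#R-g), COHERENT embeddings `emb₀ : K[9p] → K̄`,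
`emb : K[9pℓ] → K̄` (`emb ∘ incl = emb₀`), their point maps `ι_pt`, `ι_e`, the fixers `N₀ ⊇ N`, the bottom
transversal `t` (#H-a), HSY's bottom point `y₁` with #19's transport equation for `Y₁ ∈ E_p(K)` — and, at the
prime `ℓ` of the stub's Kolyvagin clause, a generator `σ_ℓ` and the CM point `y_ℓ`: the class term
`c_A(ℓ) = c(ψ_A (P_ℓ^{χ_A}))`, `P_ℓ = κ⁻¹ ι_e(D_ℓ y_ℓ)`, is WELL-FORMED (`hA₁`, `hQN`, `hP₁`: #R-g
`coupledFrame_levelPackage` + #R-c, Gross Prop. 3.6) and satisfies THE FLIP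
**`c_A(ℓ)` Selmer at `λ ∋ ℓ` ↔ `δ Y₁ ∈ T_B(λ)`** — #F1 `flip_levelPrime` with its displayed (ES2) hypothesis
DISCHARGED by `Nekovar2007.cmPoint_frobeniusCongruence` (#20) and its bottom class identified with
`kummerClassOfPoint Y₁` (#G). [cite: GrossLMS1991, Prop. 3.6, Prop. 3.7, §4 (4.1)–(4.6), Prop. 6.2]
[cite: HuShuYin2019, §4.1, Prop. 4.6] [cite: Nekovar2007, Prop. 4.9] -/
theorem block1_of_level {ω : K} (hω : ω ^ 2 + ω + 1 = 0) (h2 : Module.finrank ℚ K = 2)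
    (ι : K →+* ℂ) (hES2 : Nekovar2007.cmPoint_frobeniusCongruence)
    (Dt : ModularParametrizationData (⟨0, 0, 1, 0, -1⟩ : WeierstrassCurve ℚ) 243)
    {p ℓ : ℕ} (hp : p.Prime) (hp3 : p % 3 = 1)
    (hKol : ℓ.Prime ∧ ¬ ℓ ∣ (cubeSumCurve (3 * (p : ℚ) ^ 2)).conductorNorm ℤ ∧
      ¬ ℓ ∣ (cubeSumCurve (p : ℚ)).conductorNorm ℤ ∧ ¬ ((ℓ : ℤ) ∣ NumberField.discr K) ∧ ℓ ≠ 2 ∧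
      (Ideal.span {(ℓ : 𝓞 K)}).IsPrime ∧
      FrobEqFrobInfty (cubeSumCurve (3 * (p : ℚ) ^ 2)) K 2 ℓ ∧ FrobEqFrobInfty (cubeSumCurve (p : ℚ)) K 2 ℓ)
    -- the pinned frame transport
    (κ : geomPoints ((cubeSumCurve 9).baseChange K) ≃+
      geomPoints ((⟨0, 0, 1, 0, -1⟩ : WeierstrassCurve ℚ).baseChange K))
    (hκG : ∀ (g : absoluteGaloisGroup K) (P : geomPoints ((cubeSumCurve 9).baseChange K)),
      κ (g • P) = g • κ P)
    (hκ : ∀ {x y : AlgebraicClosure K}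
      (h : (((cubeSumCurve 9).baseChange K).baseChange (AlgebraicClosure K)).toAffine.Nonsingular x y),
      ∃ h', κ (.some x y h) = .some (x / 36) ((y - 108) / 216) h')
    -- the coupled frame (#R-g `exists_coupledFrame`)
    {vB vA : AlgebraicClosure K} (hvBc : vB ^ 3 = algebraMap ℚ (AlgebraicClosure K) ((p : ℚ) / 9))
    (hvB : vB ≠ 0)
    (hvAc : vA ^ 3 = algebraMap ℚ (AlgebraicClosure K) ((p : ℚ) ^ 2 / 3)) (hvA0 : vA ≠ 0)
    (hvB3 : ∀ g : absoluteGaloisGroup K,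
      ((show AlgebraicClosure K ≃ₐ[K] AlgebraicClosure K from g) vB) ^ 3 = vB ^ 3)
    (hvA3 : ∀ g : absoluteGaloisGroup K,
      ((show AlgebraicClosure K ≃ₐ[K] AlgebraicClosure K from g) vA) ^ 3 = vA ^ 3)
    {ψB : geomPoints ((cubeSumCurve 9).baseChange K) ≃+ geomPoints ((cubeSumCurve (p : ℚ)).baseChange K)}
    {ψA : geomPoints ((cubeSumCurve 9).baseChange K) ≃+
      geomPoints ((cubeSumCurve (3 * (p : ℚ) ^ 2)).baseChange K)}
    (hψB : ∀ {x y : AlgebraicClosure K}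
      (h : (((cubeSumCurve 9).baseChange K).baseChange (AlgebraicClosure K)).toAffine.Nonsingular x y),
      ∃ h', ψB (Affine.Point.some x y h) = Affine.Point.some (vB ^ 2 * x) (vB ^ 3 * y) h')
    (hψA : ∀ {x y : AlgebraicClosure K}
      (h : (((cubeSumCurve 9).baseChange K).baseChange (AlgebraicClosure K)).toAffine.Nonsingular x y),
      ∃ h', ψA (Affine.Point.some x y h) = Affine.Point.some (vA ^ 2 * x) (vA ^ 3 * y) h')
    {ρ : absoluteGaloisGroup K →
      geomPoints ((cubeSumCurve 9).baseChange K) ≃+ geomPoints ((cubeSumCurve 9).baseChange K)}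
    (hρ : ∀ (g : absoluteGaloisGroup K) {x y : AlgebraicClosure K}
        (h : (((cubeSumCurve 9).baseChange K).baseChange (AlgebraicClosure K)).toAffine.Nonsingular x y),
        ∃ h', ρ g (Affine.Point.some x y h) =
          Affine.Point.some (((show AlgebraicClosure K ≃ₐ[K] AlgebraicClosure K from g) vB / vB) ^ 2 * x)
            y h')
    (hρρ : ∀ (g : absoluteGaloisGroup K) {x y : AlgebraicClosure K}
        (h : (((cubeSumCurve 9).baseChange K).baseChange (AlgebraicClosure K)).toAffine.Nonsingular x y),
        ∃ h', ρ g (ρ g (Affine.Point.some x y h)) =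
          Affine.Point.some (((show AlgebraicClosure K ≃ₐ[K] AlgebraicClosure K from g) vA / vA) ^ 2 * x)
            y h')
    (hlawB : ∀ (g : absoluteGaloisGroup K) (P : geomPoints ((cubeSumCurve 9).baseChange K)),
        g • ψB P = ψB (ρ g (g • P)))
    (hlawA : ∀ (g : absoluteGaloisGroup K) (P : geomPoints ((cubeSumCurve 9).baseChange K)),
        g • ψA P = ψA (ρ g (ρ g (g • P))))
    (hρcomm : ∀ (g h : absoluteGaloisGroup K) (P : geomPoints ((cubeSumCurve 9).baseChange K)),
        h • ρ g P = ρ g (h • P))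
    -- the coherent embeddings `emb₀ : K[9p] → K̄`, `emb : K[9pℓ] → K̄` and their point maps
    (hle : ringClassField K ι (9 * p) ≤ ringClassField K ι (9 * p * ℓ))
    (emb₀ : ringClassField K ι (9 * p) →+* AlgebraicClosure K)
    (hemb₀ : ∀ k : K, emb₀ (algebraMap K (ringClassField K ι (9 * p)) k) = algebraMap K (AlgebraicClosure K) k)
    (emb : ringClassField K ι (9 * p * ℓ) →+* AlgebraicClosure K)
    (hemb : ∀ k : K, emb (algebraMap K (ringClassField K ι (9 * p * ℓ)) k) =
      algebraMap K (AlgebraicClosure K) k)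
    (hcoh : ∀ x : ringClassField K ι (9 * p), emb (RingClassField.inclusion ι hle x) = emb₀ x)
    (ιpt : letI : DecidableEq (ringClassField K ι (9 * p)) := fun a b ↦ Classical.propDecidable (a = b)
      ((⟨0, 0, 1, 0, -1⟩ : WeierstrassCurve ℚ).baseChange (ringClassField K ι (9 * p))).toAffine.Point →+
        geomPoints (((⟨0, 0, 1, 0, -1⟩ : WeierstrassCurve ℚ)).baseChange K))
    (hιpt : ∀ Q, ιpt Q = Affine.Point.map (W' := (⟨0, 0, 1, 0, -1⟩ : WeierstrassCurve ℚ)) emb₀.toRatAlgHom Q)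
    (ιe : letI : DecidableEq (ringClassField K ι (9 * p * ℓ)) := fun a b ↦ Classical.propDecidable (a = b)
      ((⟨0, 0, 1, 0, -1⟩ : WeierstrassCurve ℚ).baseChange (ringClassField K ι (9 * p * ℓ))).toAffine.Point →+
        geomPoints ((⟨0, 0, 1, 0, -1⟩ : WeierstrassCurve ℚ).baseChange K))
    (hιe : ∀ P, ιe P = Affine.Point.map (W' := (⟨0, 0, 1, 0, -1⟩ : WeierstrassCurve ℚ)) emb.toRatAlgHom P)
    -- the fixers `N₀ = Gal(K̄/emb₀ K[9p])`, `N = Gal(K̄/emb K[9pℓ])`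
    (N₀ : Subgroup (absoluteGaloisGroup K))
    (hN₀ : ∀ g : absoluteGaloisGroup K, g ∈ N₀ ↔
      ∀ x : ringClassField K ι (9 * p), (show AlgebraicClosure K ≃ₐ[K] AlgebraicClosure K from g) (emb₀ x) = emb₀ x)
    (N : Subgroup (absoluteGaloisGroup K))
    (hN : ∀ g : absoluteGaloisGroup K, g ∈ N ↔
      ∀ x : ringClassField K ι (9 * p * ℓ),
        (show AlgebraicClosure K ≃ₐ[K] AlgebraicClosure K from g) (emb x) = emb x)
    -- `∛3, ∛p ∈ K[9p]`, their stabiliser `H`, lifts `T`, the product representatives `t` (#H-a)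
    {c₃ cp : ringClassField K ι (9 * p)} (hc₃ : c₃ ^ 3 = 3) (hcp : cp ^ 3 = (p : ringClassField K ι (9 * p)))
    (H : Subgroup (ringClassField K ι (9 * p) ≃ₐ[K] ringClassField K ι (9 * p)))
    (hH : ∀ σ, σ ∈ H ↔ σ c₃ = c₃ ∧ σ cp = cp)
    [Fintype ((ringClassField K ι (9 * p) ≃ₐ[K] ringClassField K ι (9 * p)) ⧸ H)] [Fintype H]
    (T : (ringClassField K ι (9 * p) ≃ₐ[K] ringClassField K ι (9 * p)) → absoluteGaloisGroup K)
    (hT : ∀ σ (x : ringClassField K ι (9 * p)),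
      (show AlgebraicClosure K ≃ₐ[K] AlgebraicClosure K from T σ) (emb₀ x) = emb₀ (σ x))
    (t : ((ringClassField K ι (9 * p) ≃ₐ[K] ringClassField K ι (9 * p)) ⧸ H) × H → absoluteGaloisGroup K)
    (ht' : ∀ q h, t (q, h) = T (Quotient.out q) * T (h : _))
    (ht : Function.Bijective fun i ↦ (t i : absoluteGaloisGroup K ⧸ N₀))
    -- the generator `σ_ℓ` and the CM points `y_ℓ ∈ W₀(K[9pℓ])`, `y₁ ∈ W₀(K[9p])`
    {σ : ringClassField K ι (9 * p * ℓ) ≃ₐ[ℚ] ringClassField K ι (9 * p * ℓ)}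
    (hσ : Subgroup.zpowers σ = ringClassGalOver ι (9 * p * ℓ) (9 * p))
    {y : ((⟨0, 0, 1, 0, -1⟩ : WeierstrassCurve ℚ).baseChange (ringClassField K ι (9 * p * ℓ))).toAffine.Point}
    (hy : Affine.Point.map (W' := (⟨0, 0, 1, 0, -1⟩ : WeierstrassCurve ℚ))
        (ringClassField K ι (9 * p * ℓ)).subtype.toRatAlgHom y =
      Dt.φ (heegnerTau ((ℓ : ℤ) ^ 2 * (81 * ((p : ℤ) ^ 2 + 4 * p + 16)),
        (ℓ : ℤ) * (-(9 * (4 * (p : ℤ) ^ 2 + 17 * p + 72))), 4 * (p : ℤ) ^ 2 + 18 * p + 81)))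
    {y₁ : ((⟨0, 0, 1, 0, -1⟩ : WeierstrassCurve ℚ).baseChange (ringClassField K ι (9 * p))).toAffine.Point}
    (hy₁ : Affine.Point.map (W' := (⟨0, 0, 1, 0, -1⟩ : WeierstrassCurve ℚ))
        (ringClassField K ι (9 * p)).subtype.toRatAlgHom y₁ =
      Dt.φ (heegnerTau (81 * ((p : ℤ) ^ 2 + 4 * p + 16), -(9 * (4 * (p : ℤ) ^ 2 + 17 * p + 72)),
        4 * (p : ℤ) ^ 2 + 18 * p + 81)))
    -- #19's transport equation for HSY's `Y₁ ∈ E_p(K)`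
    (T₃ : ((⟨0, 0, 1, 0, -1⟩ : WeierstrassCurve ℚ).baseChange (ringClassField K ι (9 * p))).toAffine.Point)
    (hT₃ : 3 • T₃ = 0) (Y₁ : ((cubeSumCurve (p : ℚ)).baseChange K).toAffine.Point)
    (hY₁ : toGeomPoints ((cubeSumCurve (p : ℚ)).baseChange K) Y₁ =
      ψB (κ.symm (ιpt ((∑ h : H, pointGalHom (⟨0, 0, 1, 0, -1⟩ : WeierstrassCurve ℚ)
        (ringClassField K ι (9 * p)) ((h : _ ≃ₐ[K] _).restrictScalars ℚ) y₁) - T₃))))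
    (hdivA : ∀ P : geomPoints ((cubeSumCurve (3 * (p : ℚ) ^ 2)).baseChange K),
      ∃ R : geomPoints ((cubeSumCurve (3 * (p : ℚ) ^ 2)).baseChange K), ((2 : ℕ) : ℤ) • R = P)
    (hdivB : ∀ P : geomPoints ((cubeSumCurve (p : ℚ)).baseChange K),
      ∃ R : geomPoints ((cubeSumCurve (p : ℚ)).baseChange K), ((2 : ℕ) : ℤ) • R = P) :
    ∃ (hA₁ : IsAdmissible (absoluteGaloisGroup K)
        ((FixedPoints.addSubgroup N (geomPoints ((cubeSumCurve 9).baseChange K))).map ψA.toAddMonoidHom)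
        ((2 : ℕ) : ℤ))
      (_ : (∑ i, ρ (t i) (ρ (t i) (t i •
          κ.symm (ιe (KolyvaginOperator.derivOp
            (pointGalHom (⟨0, 0, 1, 0, -1⟩ : WeierstrassCurve ℚ) (ringClassField K ι (9 * p * ℓ))) σ ℓ y))))) ∈
        FixedPoints.addSubgroup N (geomPoints ((cubeSumCurve 9).baseChange K)))
      (hP₁ : ψA (∑ i, ρ (t i) (ρ (t i) (t i •
          κ.symm (ιe (KolyvaginOperator.derivOp
            (pointGalHom (⟨0, 0, 1, 0, -1⟩ : WeierstrassCurve ℚ) (ringClassField K ι (9 * p * ℓ))) σ ℓ y))))) ∈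
        invPoints (absoluteGaloisGroup K)
          ((FixedPoints.addSubgroup N (geomPoints ((cubeSumCurve 9).baseChange K))).map ψA.toAddMonoidHom)
          ((2 : ℕ) : ℤ)),
      (∀ h ∈ N, (show AlgebraicClosure K ≃ₐ[K] AlgebraicClosure K from h) vA = vA) ∧
      ∀ (v : HeightOneSpectrum (𝓞 K)), (ℓ : 𝓞 K) ∈ v.asIdeal →
        (kolyvaginClass ((cubeSumCurve (3 * (p : ℚ) ^ 2)).baseChange K) ((2 : ℕ) : ℤ) hdivA hA₁
            (ψA (∑ i, ρ (t i) (ρ (t i) (t i •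
              κ.symm (ιe (KolyvaginOperator.derivOp
                (pointGalHom (⟨0, 0, 1, 0, -1⟩ : WeierstrassCurve ℚ) (ringClassField K ι (9 * p * ℓ)))
                σ ℓ y)))))) hP₁ ∈
            selmerLocalKer ((cubeSumCurve (3 * (p : ℚ) ^ 2)).baseChange K) (v.adicCompletion K) ((2 : ℕ) : ℤ) ↔
          kummerClassOfPoint (cubeSumCurve (p : ℚ)) K Nat.prime_two Y₁ ∈
            ((cubeSumCurve (p : ℚ)).baseChange K).torsionLocalKer (v.adicCompletion K) ((2 : ℕ) : ℤ)) := by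
  -- ### basics from the clause
  obtain ⟨hℓ, hℓA, hℓB, hℓdK, hℓ2, hinert, -, hFrobB⟩ := hKol
  haveI : Fact ℓ.Prime := ⟨hℓ⟩
  obtain ⟨hℓ3, hℓp⟩ := mod_three_eq_two_of_clause hω h2 hp hp3 hℓ hℓdK hFrobB
  have hK := JZero.isImaginaryQuadratic_of_sq_add_self_add_one hω h2
  have hdK := JZero.discr_eq_neg_three_of_sq_add_self_add_one hω h2
  have hp0 : p ≠ 0 := hp.ne_zero
  have hℓ3' : ℓ ≠ 3 := by rintro rfl; norm_num at hℓ3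
  have hp_odd : Odd p := hp.eq_two_or_odd'.resolve_left (by rintro rfl; norm_num at hp3)
  have hℓ_odd : Odd ℓ := hℓ.eq_two_or_odd'.resolve_left hℓ2
  haveI := isElliptic_sylvesterNineMinimal
  haveI := isGloballyMinimal_sylvesterNineMinimal
  haveI := isElliptic_cubeSumCurve_baseChange K (n := (p : ℚ)) (by exact_mod_cast hp0)
  have hΔ := not_dvd_minimalDiscriminantInt_sylvesterNineMinimal hℓ hℓ3'
  have hMa : ((2 ^ 1 : ℕ) : ℤ) ∣ (⟨0, 0, 1, 0, -1⟩ : WeierstrassCurve ℚ).LFunction ℓ := by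
    rw [JZero.lFunction_eq_zero_of_j_eq_zero_of_mod_three_eq_two _ j_sylvesterNineMinimal hℓ hℓ3 hℓ2 hΔ]
    exact dvd_zero _
  have hMℓ : 2 ^ 1 ∣ ℓ + 1 := by rw [pow_one]; exact hℓ_odd.add_one.two_dvd
  have hn0 : 9 * p * ℓ ≠ 0 := mul_ne_zero (mul_ne_zero (by norm_num) hp0) hℓ.ne_zero
  haveI := (finiteDimensional_and_isGalois_ringClassField hK ι hn0).2
  -- ### `N₀` read at the level `9pℓ` (the binder `hN'`)
  have hN' := mem_iff_forall_mem_nine_mul ι hle emb₀ emb hcoh hN₀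
  -- ### the bottom point read at the level `9pℓ`: `y₀ = incl y₁`, `ι_e y₀ = ι_pt y₁`
  set y₀ : ((⟨0, 0, 1, 0, -1⟩ : WeierstrassCurve ℚ).baseChange (ringClassField K ι (9 * p * ℓ))).toAffine.Point :=
    Affine.Point.map (W' := (⟨0, 0, 1, 0, -1⟩ : WeierstrassCurve ℚ))
      ((RingClassField.inclusion ι hle).restrictScalars ℚ) y₁ with hy₀def
  have hy₀ : Affine.Point.map (W' := (⟨0, 0, 1, 0, -1⟩ : WeierstrassCurve ℚ))
        (ringClassField K ι (9 * p * ℓ)).subtype.toRatAlgHom y₀ =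
      Dt.φ (heegnerTau (81 * ((p : ℤ) ^ 2 + 4 * p + 16), -(9 * (4 * (p : ℤ) ^ 2 + 17 * p + 72)),
        4 * (p : ℤ) ^ 2 + 18 * p + 81)) := by
    rw [← hy₁, hy₀def]
    exact RingClassTower.map_toRatAlgHom_map_inclusion (W := (⟨0, 0, 1, 0, -1⟩ : WeierstrassCurve ℚ)) ι hle
      (ringClassField K ι (9 * p * ℓ)).subtype (ringClassField K ι (9 * p)).subtype
      (fun x' ↦ RingClassField.coe_inclusion ι hle x') y₁
  have he : ιe y₀ = ιpt y₁ := by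
    rw [hιe, hιpt, hy₀def]
    exact RingClassTower.map_toRatAlgHom_map_inclusion (W := (⟨0, 0, 1, 0, -1⟩ : WeierstrassCurve ℚ)) ι hle
      emb emb₀ hcoh y₁
  have hNN₀ : N ≤ N₀ := le_of_mem_iff_of_mem_iff_forall emb hN hN'
  -- ### Gross 3.6 + the level package (#R-c, #R-g) at `P_ℓ = κ⁻¹ ι_e(D_ℓ y_ℓ)` and at `P₁ = κ⁻¹ ι_e(y₀)`
  have hPN := map_emb_mem_fixedPoints (⟨0, 0, 1, 0, -1⟩ : WeierstrassCurve ℚ) ι emb ιe hιe N hN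
    (KolyvaginOperator.derivOp
      (pointGalHom (⟨0, 0, 1, 0, -1⟩ : WeierstrassCurve ℚ) (ringClassField K ι (9 * p * ℓ))) σ ℓ y)
  have hPℓN := mem_fixedPoints_symm_of_equivariant κ hκG N hPN
  have hPraw := exists_fixedPoints_zsmul_eq_smul_map_derivOp_sub hK hdK ι Dt hp3 hℓ hℓ3 hℓp hinert hMℓ hMa
    hσ hy hy₀ emb hemb ιe hιe N hN N₀ hN'
  obtain ⟨hNn, -, -, hN'vA, -, hA₂', hA₁', -, hP₁'⟩ := coupledFrame_levelPackage hω h2 ι hp0 hℓ.ne_zero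
    hp_odd hℓ_odd hvBc hvB hvAc hvA0 hvB3 hvA3 hρ hρρ hlawB hlawA emb hemb N hN N₀ hN' t ht 1 _ hPℓN
    (fun h hh ↦ exists_fixedPoints_zsmul_eq_symm_of_equivariant κ hκG N (hPraw h hh))
  have hy₀N := mem_fixedPoints_symm_of_equivariant κ hκG N
    (map_emb_mem_fixedPoints (⟨0, 0, 1, 0, -1⟩ : WeierstrassCurve ℚ) ι emb ιe hιe N hN y₀)
  have hfix₀ : ∀ h ∈ N₀, h • κ.symm (ιe y₀) = κ.symm (ιe y₀) := fun h hh ↦ by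
    apply κ.injective
    rw [hκG, κ.apply_symm_apply, he]
    exact smul_embPoints_eq_self (⟨0, 0, 1, 0, -1⟩ : WeierstrassCurve ℚ) emb₀ ιpt hιpt h ((hN₀ h).mp hh) y₁
  obtain ⟨-, -, -, -, -, -, -, hP₂', -⟩ := coupledFrame_levelPackage hω h2 ι hp0 hℓ.ne_zero
    hp_odd hℓ_odd hvBc hvB hvAc hvA0 hvB3 hvA3 hρ hρρ hlawB hlawA emb hemb N hN N₀ hN' t ht 1 _ hy₀N
    (fun h hh ↦ ⟨0, AddSubgroup.zero_mem _, by rw [smul_zero, hfix₀ h hh, sub_self]⟩)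
  have hA₁ : IsAdmissible (absoluteGaloisGroup K)
      ((FixedPoints.addSubgroup N (geomPoints ((cubeSumCurve 9).baseChange K))).map ψA.toAddMonoidHom)
      ((2 : ℕ) : ℤ) := hA₁'
  have hA₂ : IsAdmissible (absoluteGaloisGroup K)
      ((FixedPoints.addSubgroup N (geomPoints ((cubeSumCurve 9).baseChange K))).map ψB.toAddMonoidHom)
      ((2 : ℕ) : ℤ) := hA₂'
  have hP₁ : ψA (∑ i, ρ (t i) (ρ (t i) (t i •
      κ.symm (ιe (KolyvaginOperator.derivOp
        (pointGalHom (⟨0, 0, 1, 0, -1⟩ : WeierstrassCurve ℚ) (ringClassField K ι (9 * p * ℓ))) σ ℓ y))))) ∈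
      invPoints (absoluteGaloisGroup K)
        ((FixedPoints.addSubgroup N (geomPoints ((cubeSumCurve 9).baseChange K))).map ψA.toAddMonoidHom)
        ((2 : ℕ) : ℤ) := hP₁'
  have hP₂ : ψB (∑ i, ρ (t i) (t i • κ.symm (ιe y₀))) ∈
      invPoints (absoluteGaloisGroup K)
        ((FixedPoints.addSubgroup N (geomPoints ((cubeSumCurve 9).baseChange K))).map ψB.toAddMonoidHom)
        ((2 : ℕ) : ℤ) := hP₂'
  haveI : N.Normal := hNn
  have hQN : (∑ i, ρ (t i) (ρ (t i) (t i •
      κ.symm (ιe (KolyvaginOperator.derivOp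
        (pointGalHom (⟨0, 0, 1, 0, -1⟩ : WeierstrassCurve ℚ) (ringClassField K ι (9 * p * ℓ))) σ ℓ y))))) ∈
      FixedPoints.addSubgroup N (geomPoints ((cubeSumCurve 9).baseChange K)) :=
    chiComponent_mem (fun g ↦ ((ρ g).trans (ρ g)).toAddMonoidHom)
      (fun g _ ha ↦ JZero.smul_mem_fixedPoints _ N g ha)
      (fun g _ ha ↦ JZero.rho_mem_fixedPoints _ hω hvB hvB3 hρ N g (JZero.rho_mem_fixedPoints _ hω hvB hvB3 hρ N g ha))
      t hPℓN
  -- ### the general-shape reading of the pinned `κ` (#F1's `hκ`)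
  have hκ' : ∀ {x y : AlgebraicClosure K}
      (h : (((cubeSumCurve 9).baseChange K).baseChange (AlgebraicClosure K)).toAffine.Nonsingular x y),
      ∃ h', κ (.some x y h) = .some ((36 : AlgebraicClosure K)⁻¹ * x)
        ((216 : AlgebraicClosure K)⁻¹ * y + -(1 / 2)) h' := by
    intro x y h
    obtain ⟨h', e⟩ := hκ h
    have ex : x / 36 = (36 : AlgebraicClosure K)⁻¹ * x := by ring
    have ey : (y - 108) / 216 = (216 : AlgebraicClosure K)⁻¹ * y + -(1 / 2) := by ring
    exact ⟨ex ▸ ey ▸ h', e.trans (Affine.Point.some_eq_some_of_eq ex ey)⟩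
  -- ### (ES2) from the named fact (#20), read through `ι_e`
  have hES : ∀ (φ₀ : absoluteGaloisGroup (ZMod ℓ)), (∀ x : AlgebraicClosure (ZMod ℓ), φ₀ • x = x ^ ℓ) →
      ∀ g : absoluteGaloisGroup K,
        geomReduction hΔ ((RatClosure.pointsEquiv (K := K) (⟨0, 0, 1, 0, -1⟩ : WeierstrassCurve ℚ)).symm
            (g • ιe y)) =
          φ₀ • geomReduction hΔ ((RatClosure.pointsEquiv (K := K)
            (⟨0, 0, 1, 0, -1⟩ : WeierstrassCurve ℚ)).symm (g • ιe y₀)) := by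
    intro φ₀ hφ₀ g
    rw [hιe, hιe]
    exact geomReduction_sylvester_prime_eq_frob_smul hES2 hK hdK ι Dt hp3 hℓ2 hℓ3 hℓp hinert hy hy₀
      (Affine.Point.map (W' := (⟨0, 0, 1, 0, -1⟩ : WeierstrassCurve ℚ)) emb.toRatAlgHom) emb
      (fun hab ↦ ⟨_, rfl⟩) hΔ hφ₀ g
  -- ### THE FLIP (#F1)
  have hflip := flip_levelPrime hω h2 ι Dt hp hp3 hℓ3 hℓ2 hℓp hℓA hℓB hℓdK hFrobB hΔ κ hκG hκ' hvBc hvB hvAc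
    hvA0 hvB3 hvA3 hψB hψA hρ hρρ hlawB hlawA hρcomm emb hemb ιe hιe N hN N₀ hN' t ht hσ hy hy₀
    (hdivA := hdivA) (hdivB := hdivB) hA₁ hA₂ hP₁ hP₂ hES
  -- ### the bottom class IS `δ Y₁` (#G)
  have hm0 : 9 * p ≠ 0 := mul_ne_zero (by norm_num) hp0
  haveI := (finiteDimensional_and_isGalois_ringClassField hK ι hm0).1
  obtain ⟨T₀, hT₀, hbot⟩ := bottom_chiComponent_eq_toGeomPoints hω ι hp0 κ hκG hvBc hvB hvB3 hρ hlawB hρcomm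
    emb₀ ιpt hιpt N₀ hN₀ hc₃ hcp H hH T hT t ht' ht y₁ T₃ hT₃ Y₁ hY₁
  have hodd : Odd ((Fintype.card ((ringClassField K ι (9 * p) ≃ₐ[K] ringClassField K ι (9 * p)) ⧸ H) : ℕ) : ℤ) := by
    have h := odd_card_quotient_stabilizer hω hc₃ hp0 hcp H hH
    rw [Nat.card_eq_fintype_card] at h
    exact_mod_cast h
  have hQe : ψB (∑ i, ρ (t i) (t i • κ.symm (ιe y₀))) =
      toGeomPoints ((cubeSumCurve (p : ℚ)).baseChange K)
        ((Fintype.card ((ringClassField K ι (9 * p) ≃ₐ[K] ringClassField K ι (9 * p)) ⧸ H) : ℤ) • Y₁ + T₀) := by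
    rw [he]; exact hbot
  have hcls := kolyvaginClass_eq_kummerClassOfPoint_of_eq (cubeSumCurve (p : ℚ)) (hdiv := hdivB) hA₂ Y₁ T₀ hT₀
    hodd hQe hP₂
  refine ⟨hA₁, hQN, hP₁, fun h hh ↦ hN'vA h (hNN₀ hh), fun v hv ↦ ?_⟩
  have h := hflip v hv
  rwa [hcls] at h

end Summit.BirchSwinnertonDyer.BirchSwinnertonDyer.Theorems.SylvesterTwoCMFlip

end
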